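import Summits.AtomisticToContinuum.FouriersLaw.Theorems.BondHeatUncertaintyLinearResponseFTURSteadyHeatRatesHelper1
import Literature.MathematicalPhysics.KineticTheory.PhaseSpacePoisson
import Literature.MathematicalPhysics.KineticTheory.LangevinChainScalingLimit

/-!
# Sign-free generator calculus for the window-limit argument (helper for `WindowLimit`)

Helper file for the route item `ParityLiouvilleSeed.WindowLimit` (`stmt-AtomisticToContinuum-13982`,
bulk-window compactness + stationarity transfer). The item carries NO sign conditions on the
parameters `ω₂, lam, β, γ, T_L, T_R` (the sector `γ < 0` is non-vacuous: momentum reversal maps steady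
states of `(γ, T_L, T_R)` to steady states of `(-γ, T_L, T_R)`), so the energy cut-off `χ(H/R)` of the
tree (which needs a confining `H`) is replaced by the cut-off `χ(H₀/R)` in the REFERENCE quadratic
energy `H₀ = ∑ (p_i² + q_i²)/2` (the Hamiltonian of the uncoupled harmonic chain `U = q²/2`, `V = 0`),
and the product rule is proved for `OscillatorChain.generator` directly (no `√(2γT)`):

* `partialP_partialP_mul`, `generator_mul` — `L(fg) = f Lg + g Lf + 2γ ∑_b T_b ∂_{p_b}f ∂_{p_b}g`
  for `C²` functions and ANY real parameters; `generator_mul_of_partialP_bath_eq_zero` — no cross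
  term when `f` does not depend on the bath momenta;
* `refHamiltonian_eq`, `partialQ_refHamiltonian`, `norm_sq_le_two_mul_refHamiltonian`,
  `isCompact_setOf_refHamiltonian_le` — the reference energy;
* `generator_refCutoff_eq`, `abs_generator_refCutoff_le`, `eventually_generator_refCutoff_eq_zero`,
  `hasCompactSupport_mul_refCutoff` — the cut-off `χ(H₀/R)`: closed form of `L χ(H₀/R)` for an
  arbitrary chain `P`, a bound uniform in `R ≥ 1`, and its eventual vanishing at a fixed point.

Nothing here closes an item.
-/

noncomputable section

namespace Summit.AtomisticToContinuum.FouriersLaw.Theorems.WindowLimit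

open MeasureTheory Filter Topology Set
open scoped ContDiff
open Literature.MathematicalPhysics.KineticTheory
open Literature.MathematicalPhysics.KineticTheory.HeatConduction
open Summit.AtomisticToContinuum.FouriersLaw.Theorems.SubdiffusiveBondHeat
open Summit.AtomisticToContinuum.FouriersLaw.Theorems.LinearResponseFTUR

variable {N : ℕ}

/-! ### The product rule for the generator, any real parameters -/

/-- `∂²_{p_i}(fg) = f ∂²g + 2 ∂f ∂g + g ∂²f` for `C²` functions. [folklore] -/
theorem partialP_partialP_mul {f g : PhaseSpace N → ℝ} (hf : ContDiff ℝ 2 f) (hg : ContDiff ℝ 2 g)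
    (i : Fin N) (x : PhaseSpace N) :
    partialP i (partialP i (f * g)) x =
      f x * partialP i (partialP i g) x + 2 * (partialP i f x * partialP i g x) +
        g x * partialP i (partialP i f) x := by
  have hfd : Differentiable ℝ f := hf.differentiable (by norm_num)
  have hgd : Differentiable ℝ g := hg.differentiable (by norm_num)
  have hfd1 : Differentiable ℝ (partialP i f) :=
    (contDiff_partialP hf (m := 1) (by norm_num) i).differentiable one_ne_zero
  have hgd1 : Differentiable ℝ (partialP i g) :=
    (contDiff_partialP hg (m := 1) (by norm_num) i).differentiable one_ne_zero
  have h1 : partialP i (f * g) = f * partialP i g + g * partialP i f := by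
    funext y; rw [partialP_mul hfd hgd]; rfl
  rw [h1, partialP_add (hfd.mul hgd1) (hgd.mul hfd1), partialP_mul hfd hgd1, partialP_mul hgd hfd1]
  ring

/-- **Product rule for the Langevin generator** (carré du champ of the two Ornstein–Uhlenbeck baths),
for `C²` functions and arbitrary real `γ, T_L, T_R`:
`L(fg) = f Lg + g Lf + γ ∑_i ([i=0] 2T_L ∂_{p_i}f ∂_{p_i}g + [i=N-1] 2T_R ∂_{p_i}f ∂_{p_i}g)`.
[Bakry–Gentil–Ledoux 2014, §1.4.2] [folklore] -/
theorem generator_mul (P : OscillatorChain) (T_L T_R : ℝ) {f g : PhaseSpace N → ℝ}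
    (hf : ContDiff ℝ 2 f) (hg : ContDiff ℝ 2 g) (x : PhaseSpace N) :
    P.generator N T_L T_R (f * g) x =
      f x * P.generator N T_L T_R g x + g x * P.generator N T_L T_R f x +
        P.γ * ∑ i : Fin N, ((if i.val = 0 then 2 * T_L * (partialP i f x * partialP i g x) else 0) +
          (if i.val = N - 1 then 2 * T_R * (partialP i f x * partialP i g x) else 0)) := by
  have hfd : Differentiable ℝ f := hf.differentiable (by norm_num)
  have hgd : Differentiable ℝ g := hg.differentiable (by norm_num)
  simp only [OscillatorChain.generator, partialQ_mul hfd hgd, partialP_mul hfd hgd,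
    partialP_partialP_mul hf hg]
  simp only [Finset.mul_sum, mul_add, ← Finset.sum_add_distrib]
  refine Finset.sum_congr rfl fun i _ => ?_
  split_ifs <;> ring

/-- Product rule without cross term: if `f` does not depend on the bath momenta
(`∂_{p_0} f = ∂_{p_{N-1}} f = 0`), then `L(fg) = f Lg + g Lf`. [folklore] -/
theorem generator_mul_of_partialP_bath_eq_zero (P : OscillatorChain) (T_L T_R : ℝ)
    {f g : PhaseSpace N → ℝ} (hf : ContDiff ℝ 2 f) (hg : ContDiff ℝ 2 g)
    (h0 : ∀ i : Fin N, i.val = 0 → ∀ x, partialP i f x = 0)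
    (h1 : ∀ i : Fin N, i.val = N - 1 → ∀ x, partialP i f x = 0) (x : PhaseSpace N) :
    P.generator N T_L T_R (f * g) x =
      f x * P.generator N T_L T_R g x + g x * P.generator N T_L T_R f x := by
  rw [generator_mul P T_L T_R hf hg x]
  have : ∑ i : Fin N, ((if i.val = 0 then 2 * T_L * (partialP i f x * partialP i g x) else 0) +
      (if i.val = N - 1 then 2 * T_R * (partialP i f x * partialP i g x) else 0)) = 0 := by
    refine Finset.sum_eq_zero fun i _ => ?_
    by_cases hi0 : i.val = 0 <;> by_cases hi1 : i.val = N - 1 <;> simp [hi0, hi1, h0, h1]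
  rw [this, mul_zero, add_zero]

/-! ### The reference quadratic energy `H₀ = ∑ (p_i² + q_i²)/2` -/

/- The reference (uncoupled harmonic) chain `U(q) = q²/2`, `V = 0`, `γ = 0` is written literally as
`(⟨fun q => q ^ 2 / 2, fun _ => 0, 0⟩ : OscillatorChain)` below (no notation, no definition); its
Hamiltonian is the confining quadratic energy `H₀` used for the cut-offs. -/

/-- `H₀(q, p) = ∑_i (p_i²/2 + q_i²/2)`. [folklore] -/
theorem refHamiltonian_eq (x : PhaseSpace N) :
    (⟨fun q => q ^ 2 / 2, fun _ => 0, 0⟩ : OscillatorChain).hamiltonian N x = ∑ i, (x.2 i ^ 2 / 2 + x.1 i ^ 2 / 2) := by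
  simp [OscillatorChain.hamiltonian]

/-- `H₀` is smooth. [folklore] -/
theorem contDiff_refHamiltonian {n : WithTop ℕ∞} : ContDiff ℝ n ((⟨fun q => q ^ 2 / 2, fun _ => 0, 0⟩ : OscillatorChain).hamiltonian N) :=
  OscillatorChain.contDiff_hamiltonian _ ((contDiff_id.pow 2).div_const 2) contDiff_const N

/-- `H₀` is differentiable. [folklore] -/
theorem differentiable_refHamiltonian : Differentiable ℝ ((⟨fun q => q ^ 2 / 2, fun _ => 0, 0⟩ : OscillatorChain).hamiltonian N) :=
  (contDiff_refHamiltonian (n := 1)).differentiable one_ne_zero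

/-- `∂_{q_i} H₀ = q_i`. [folklore] -/
theorem partialQ_refHamiltonian (x : PhaseSpace N) (i : Fin N) :
    partialQ i ((⟨fun q => q ^ 2 / 2, fun _ => 0, 0⟩ : OscillatorChain).hamiltonian N) x = x.1 i := by
  have hU : Differentiable ℝ (⟨fun q => q ^ 2 / 2, fun _ => 0, 0⟩ : OscillatorChain).U := ((differentiable_id.pow 2).div_const 2)
  have hV : Differentiable ℝ (⟨fun q => q ^ 2 / 2, fun _ => 0, 0⟩ : OscillatorChain).V := differentiable_const _
  rw [OscillatorChain.partialQ_hamiltonian_eq_dPotential _ hU hV, OscillatorChain.dPotential_eq_closed]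
  have hdU : deriv (⟨fun q => q ^ 2 / 2, fun _ => 0, 0⟩ : OscillatorChain).U (x.1 i) = x.1 i := by
    show deriv (fun q : ℝ => q ^ 2 / 2) (x.1 i) = x.1 i
    have h : HasDerivAt (fun q : ℝ => q ^ 2 / 2) (2 * x.1 i ^ 1 * 1 / 2) (x.1 i) :=
      ((hasDerivAt_id (x.1 i)).pow 2).div_const 2
    rw [h.deriv]; ring
  have hdV : ∀ r, deriv (⟨fun q => q ^ 2 / 2, fun _ => 0, 0⟩ : OscillatorChain).V r = 0 := fun r => by
    show deriv (fun _ : ℝ => (0 : ℝ)) r = 0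
    exact deriv_const r 0
  simp [hdU, hdV]

/-- `∂_{p_i} H₀ = p_i`. [folklore] -/
theorem partialP_refHamiltonian (x : PhaseSpace N) (i : Fin N) :
    partialP i ((⟨fun q => q ^ 2 / 2, fun _ => 0, 0⟩ : OscillatorChain).hamiltonian N) x = x.2 i :=
  OscillatorChain.partialP_hamiltonian _ N x i

/-- `0 ≤ H₀`. [folklore] -/
theorem refHamiltonian_nonneg (x : PhaseSpace N) : 0 ≤ (⟨fun q => q ^ 2 / 2, fun _ => 0, 0⟩ : OscillatorChain).hamiltonian N x := by
  rw [refHamiltonian_eq]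
  exact Finset.sum_nonneg fun i _ => by positivity

/-- `q_i² ≤ 2H₀` and `p_i² ≤ 2H₀`. [folklore] -/
theorem sq_le_two_mul_refHamiltonian (x : PhaseSpace N) (i : Fin N) :
    x.1 i ^ 2 ≤ 2 * (⟨fun q => q ^ 2 / 2, fun _ => 0, 0⟩ : OscillatorChain).hamiltonian N x ∧ x.2 i ^ 2 ≤ 2 * (⟨fun q => q ^ 2 / 2, fun _ => 0, 0⟩ : OscillatorChain).hamiltonian N x := by
  rw [refHamiltonian_eq]
  have h := Finset.single_le_sum (f := fun k : Fin N => x.2 k ^ 2 / 2 + x.1 k ^ 2 / 2)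
    (fun k _ => by positivity) (Finset.mem_univ i)
  constructor <;> nlinarith [sq_nonneg (x.1 i), sq_nonneg (x.2 i)]

/-- `‖x‖² ≤ 2 H₀(x)` (sup norm of phase space). [folklore] -/
theorem norm_sq_le_two_mul_refHamiltonian (x : PhaseSpace N) :
    ‖x‖ ^ 2 ≤ 2 * (⟨fun q => q ^ 2 / 2, fun _ => 0, 0⟩ : OscillatorChain).hamiltonian N x := by
  have h0 : 0 ≤ 2 * (⟨fun q => q ^ 2 / 2, fun _ => 0, 0⟩ : OscillatorChain).hamiltonian N x := by linarith [refHamiltonian_nonneg x]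
  have hq : ‖x.1‖ ^ 2 ≤ 2 * (⟨fun q => q ^ 2 / 2, fun _ => 0, 0⟩ : OscillatorChain).hamiltonian N x := by
    have h1 : ‖x.1‖ ≤ Real.sqrt (2 * (⟨fun q => q ^ 2 / 2, fun _ => 0, 0⟩ : OscillatorChain).hamiltonian N x) := by
      refine (pi_norm_le_iff_of_nonneg (Real.sqrt_nonneg _)).2 fun i => ?_
      rw [Real.norm_eq_abs, ← Real.sqrt_sq_eq_abs]
      exact Real.sqrt_le_sqrt (sq_le_two_mul_refHamiltonian x i).1
    calc ‖x.1‖ ^ 2 ≤ Real.sqrt (2 * (⟨fun q => q ^ 2 / 2, fun _ => 0, 0⟩ : OscillatorChain).hamiltonian N x) ^ 2 := by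
          gcongr
      _ = 2 * (⟨fun q => q ^ 2 / 2, fun _ => 0, 0⟩ : OscillatorChain).hamiltonian N x := Real.sq_sqrt h0
  have hp : ‖x.2‖ ^ 2 ≤ 2 * (⟨fun q => q ^ 2 / 2, fun _ => 0, 0⟩ : OscillatorChain).hamiltonian N x := by
    have h1 : ‖x.2‖ ≤ Real.sqrt (2 * (⟨fun q => q ^ 2 / 2, fun _ => 0, 0⟩ : OscillatorChain).hamiltonian N x) := by
      refine (pi_norm_le_iff_of_nonneg (Real.sqrt_nonneg _)).2 fun i => ?_
      rw [Real.norm_eq_abs, ← Real.sqrt_sq_eq_abs]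
      exact Real.sqrt_le_sqrt (sq_le_two_mul_refHamiltonian x i).2
    calc ‖x.2‖ ^ 2 ≤ Real.sqrt (2 * (⟨fun q => q ^ 2 / 2, fun _ => 0, 0⟩ : OscillatorChain).hamiltonian N x) ^ 2 := by
          gcongr
      _ = 2 * (⟨fun q => q ^ 2 / 2, fun _ => 0, 0⟩ : OscillatorChain).hamiltonian N x := Real.sq_sqrt h0
  rw [Prod.norm_def]
  rcases le_total ‖x.1‖ ‖x.2‖ with h | h
  · rw [max_eq_right h]; exact hp
  · rw [max_eq_left h]; exact hq

/-- The sublevel sets `{H₀ ≤ E}` are compact. [folklore] -/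
theorem isCompact_setOf_refHamiltonian_le (N : ℕ) (E : ℝ) :
    IsCompact {x : PhaseSpace N | (⟨fun q => q ^ 2 / 2, fun _ => 0, 0⟩ : OscillatorChain).hamiltonian N x ≤ E} := by
  have hclosed : IsClosed {x : PhaseSpace N | (⟨fun q => q ^ 2 / 2, fun _ => 0, 0⟩ : OscillatorChain).hamiltonian N x ≤ E} :=
    isClosed_le (contDiff_refHamiltonian (n := 0)).continuous continuous_const
  refine (isCompact_closedBall (0 : PhaseSpace N) (Real.sqrt (2 * E))).of_isClosed_subset hclosed ?_
  intro x hx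
  rw [Metric.mem_closedBall, dist_zero_right, ← Real.sqrt_sq (norm_nonneg x)]
  exact Real.sqrt_le_sqrt ((norm_sq_le_two_mul_refHamiltonian x).trans (by linarith [hx.out]))

/-! ### The reference cut-off `χ(H₀/R)` -/

/-- `χ(H₀/R)` is smooth. [folklore] -/
theorem contDiff_refCutoff (R : ℝ) {n : ℕ∞} :
    ContDiff ℝ n fun y : PhaseSpace N => smoothCutoff ((⟨fun q => q ^ 2 / 2, fun _ => 0, 0⟩ : OscillatorChain).hamiltonian N y / R) :=
  contDiff_smoothCutoff.comp (contDiff_refHamiltonian.div_const R)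

/-- A continuous function times `χ(H₀/R)` (`R > 0`) has compact support (inside `{H₀ ≤ 2R}`).
[folklore] -/
theorem hasCompactSupport_mul_refCutoff {R : ℝ} (hR : 0 < R) (w : PhaseSpace N → ℝ) :
    HasCompactSupport (fun y : PhaseSpace N => w y * smoothCutoff ((⟨fun q => q ^ 2 / 2, fun _ => 0, 0⟩ : OscillatorChain).hamiltonian N y / R)) := by
  refine HasCompactSupport.intro (isCompact_setOf_refHamiltonian_le N (2 * R)) fun x hx => ?_
  simp only [mem_setOf_eq, not_le] at hx
  have h2 : 2 ≤ (⟨fun q => q ^ 2 / 2, fun _ => 0, 0⟩ : OscillatorChain).hamiltonian N x / R := by rw [le_div_iff₀ hR]; linarith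
  rw [smoothCutoff_of_two_le h2, mul_zero]

/-- **`L χ(H₀/R)` in closed form**, for an arbitrary chain `P` and bath temperatures:
`L χ(H₀/R) = ∑_i (p_i χ' q_i - ∂_{q_i}H_P χ' p_i)/R + γ ∑_b (T_b (χ'' p_b²/R² + χ'/R) - χ' p_b²/R)`
(primes at `H₀/R`). [folklore] -/
theorem generator_refCutoff_eq (P : OscillatorChain) (T_L T_R R : ℝ) (x : PhaseSpace N) :
    P.generator N T_L T_R (fun y => smoothCutoff ((⟨fun q => q ^ 2 / 2, fun _ => 0, 0⟩ : OscillatorChain).hamiltonian N y / R)) x =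
      (∑ i : Fin N, (x.2 i * (deriv smoothCutoff ((⟨fun q => q ^ 2 / 2, fun _ => 0, 0⟩ : OscillatorChain).hamiltonian N x / R) / R * x.1 i) -
        partialQ i (P.hamiltonian N) x * (deriv smoothCutoff ((⟨fun q => q ^ 2 / 2, fun _ => 0, 0⟩ : OscillatorChain).hamiltonian N x / R) / R * x.2 i))) +
      P.γ * ∑ i : Fin N,
        ((if i.val = 0 then
            T_L * (deriv (deriv smoothCutoff) ((⟨fun q => q ^ 2 / 2, fun _ => 0, 0⟩ : OscillatorChain).hamiltonian N x / R) / R ^ 2 * x.2 i ^ 2 +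
              deriv smoothCutoff ((⟨fun q => q ^ 2 / 2, fun _ => 0, 0⟩ : OscillatorChain).hamiltonian N x / R) / R) -
            x.2 i * (deriv smoothCutoff ((⟨fun q => q ^ 2 / 2, fun _ => 0, 0⟩ : OscillatorChain).hamiltonian N x / R) / R * x.2 i) else 0) +
          (if i.val = N - 1 then
            T_R * (deriv (deriv smoothCutoff) ((⟨fun q => q ^ 2 / 2, fun _ => 0, 0⟩ : OscillatorChain).hamiltonian N x / R) / R ^ 2 * x.2 i ^ 2 +
              deriv smoothCutoff ((⟨fun q => q ^ 2 / 2, fun _ => 0, 0⟩ : OscillatorChain).hamiltonian N x / R) / R) -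
            x.2 i * (deriv smoothCutoff ((⟨fun q => q ^ 2 / 2, fun _ => 0, 0⟩ : OscillatorChain).hamiltonian N x / R) / R * x.2 i) else 0)) := by
  have hF := hasDerivAt_scaled_smoothCutoff R
  have hF' := hasDerivAt_deriv_scaled_smoothCutoff R
  simp only [OscillatorChain.generator,
    OscillatorChain.partialQ_comp_hamiltonian _ differentiable_refHamiltonian hF,
    OscillatorChain.partialP_comp_hamiltonian _ hF,
    OscillatorChain.partialP_deriv_comp_hamiltonian_mul _ hF', partialQ_refHamiltonian]

/-- **Uniform bound for `L χ(H₀/R)`, `R ≥ 1`**: with `‖χ'‖_∞ ≤ M₁`, `‖χ''‖_∞ ≤ M₂`,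
`|L χ(H₀/R)(x)| ≤ M₁ ∑_i (|p_i| |q_i| + |∂_{q_i}H_P| |p_i|) + |γ| ((|T_L| + |T_R|) (M₂ ‖x‖² + M₁) + 2 M₁ ‖x‖²)`.
[folklore] -/
theorem abs_generator_refCutoff_le (P : OscillatorChain) (T_L T_R : ℝ) {M₁ M₂ : ℝ} (hM₁0 : 0 ≤ M₁)
    (hM₁ : ∀ u, |deriv smoothCutoff u| ≤ M₁) (hM₂0 : 0 ≤ M₂)
    (hM₂ : ∀ u, |deriv (deriv smoothCutoff) u| ≤ M₂) {R : ℝ} (hR : 1 ≤ R) (x : PhaseSpace N) :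
    |P.generator N T_L T_R (fun y => smoothCutoff ((⟨fun q => q ^ 2 / 2, fun _ => 0, 0⟩ : OscillatorChain).hamiltonian N y / R)) x| ≤
      M₁ * ∑ i : Fin N, (|x.2 i| * |x.1 i| + |partialQ i (P.hamiltonian N) x| * |x.2 i|) +
        |P.γ| * ((|T_L| + |T_R|) * (M₂ * ‖x‖ ^ 2 + M₁) + 2 * M₁ * ‖x‖ ^ 2) := by
  rw [generator_refCutoff_eq P T_L T_R R x]
  set d := deriv smoothCutoff ((⟨fun q => q ^ 2 / 2, fun _ => 0, 0⟩ : OscillatorChain).hamiltonian N x / R) with hd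
  set dd := deriv (deriv smoothCutoff) ((⟨fun q => q ^ 2 / 2, fun _ => 0, 0⟩ : OscillatorChain).hamiltonian N x / R) with hdd
  have hR0 : 0 < R := by linarith
  have hdR : |d / R| ≤ M₁ := by
    rw [abs_div, abs_of_pos hR0]
    exact (div_le_self (abs_nonneg _) hR).trans (hM₁ _)
  have hddR : |dd / R ^ 2| ≤ M₂ := by
    rw [abs_div, abs_of_pos (by positivity : (0:ℝ) < R ^ 2)]
    exact (div_le_self (abs_nonneg _) (by nlinarith)).trans (hM₂ _)
  have hpi : ∀ i : Fin N, |x.2 i| ≤ ‖x‖ := fun i =>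
    (Real.norm_eq_abs _ ▸ norm_le_pi_norm x.2 i).trans (norm_snd_le x)
  have hpi2 : ∀ i : Fin N, x.2 i ^ 2 ≤ ‖x‖ ^ 2 := fun i => by
    rw [← sq_abs]; exact pow_le_pow_left₀ (abs_nonneg _) (hpi i) 2
  -- Hamiltonian part
  have h1 : |∑ i : Fin N, (x.2 i * (d / R * x.1 i) - partialQ i (P.hamiltonian N) x * (d / R * x.2 i))| ≤
      M₁ * ∑ i : Fin N, (|x.2 i| * |x.1 i| + |partialQ i (P.hamiltonian N) x| * |x.2 i|) := by
    rw [Finset.mul_sum]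
    refine (Finset.abs_sum_le_sum_abs _ _).trans (Finset.sum_le_sum fun i _ => ?_)
    have e1 : |x.2 i * (d / R * x.1 i)| ≤ M₁ * (|x.2 i| * |x.1 i|) := by
      rw [show x.2 i * (d / R * x.1 i) = d / R * (x.2 i * x.1 i) by ring, abs_mul, abs_mul]
      exact mul_le_mul_of_nonneg_right hdR (by positivity)
    have e2 : |partialQ i (P.hamiltonian N) x * (d / R * x.2 i)| ≤
        M₁ * (|partialQ i (P.hamiltonian N) x| * |x.2 i|) := by
      rw [show partialQ i (P.hamiltonian N) x * (d / R * x.2 i) =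
        d / R * (partialQ i (P.hamiltonian N) x * x.2 i) by ring, abs_mul, abs_mul]
      exact mul_le_mul_of_nonneg_right hdR (by positivity)
    calc |x.2 i * (d / R * x.1 i) - partialQ i (P.hamiltonian N) x * (d / R * x.2 i)|
        ≤ |x.2 i * (d / R * x.1 i)| + |partialQ i (P.hamiltonian N) x * (d / R * x.2 i)| := abs_sub _ _
      _ ≤ M₁ * (|x.2 i| * |x.1 i|) + M₁ * (|partialQ i (P.hamiltonian N) x| * |x.2 i|) := add_le_add e1 e2
      _ = M₁ * (|x.2 i| * |x.1 i| + |partialQ i (P.hamiltonian N) x| * |x.2 i|) := by ring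
  -- bath part: each bath term is bounded by `|T|(M₂‖x‖² + M₁) + M₁‖x‖²`
  have hbath : ∀ (T : ℝ) (i : Fin N),
      |T * (dd / R ^ 2 * x.2 i ^ 2 + d / R) - x.2 i * (d / R * x.2 i)| ≤
        |T| * (M₂ * ‖x‖ ^ 2 + M₁) + M₁ * ‖x‖ ^ 2 := by
    intro T i
    have e1 : |dd / R ^ 2 * x.2 i ^ 2 + d / R| ≤ M₂ * ‖x‖ ^ 2 + M₁ := by
      refine (abs_add_le _ _).trans (add_le_add ?_ hdR)
      rw [abs_mul, abs_of_nonneg (sq_nonneg (x.2 i))]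
      exact mul_le_mul hddR (hpi2 i) (sq_nonneg _) hM₂0
    have e2 : |x.2 i * (d / R * x.2 i)| ≤ M₁ * ‖x‖ ^ 2 := by
      rw [show x.2 i * (d / R * x.2 i) = d / R * x.2 i ^ 2 by ring, abs_mul,
        abs_of_nonneg (sq_nonneg (x.2 i))]
      exact mul_le_mul hdR (hpi2 i) (sq_nonneg _) hM₁0
    calc |T * (dd / R ^ 2 * x.2 i ^ 2 + d / R) - x.2 i * (d / R * x.2 i)|
        ≤ |T * (dd / R ^ 2 * x.2 i ^ 2 + d / R)| + |x.2 i * (d / R * x.2 i)| := abs_sub _ _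
      _ ≤ |T| * (M₂ * ‖x‖ ^ 2 + M₁) + M₁ * ‖x‖ ^ 2 := by
          rw [abs_mul]
          exact add_le_add (mul_le_mul_of_nonneg_left e1 (abs_nonneg _)) e2
  have h2 : |∑ i : Fin N,
      ((if i.val = 0 then T_L * (dd / R ^ 2 * x.2 i ^ 2 + d / R) - x.2 i * (d / R * x.2 i) else 0) +
        (if i.val = N - 1 then T_R * (dd / R ^ 2 * x.2 i ^ 2 + d / R) - x.2 i * (d / R * x.2 i) else 0))| ≤
      (|T_L| + |T_R|) * (M₂ * ‖x‖ ^ 2 + M₁) + 2 * M₁ * ‖x‖ ^ 2 := by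
    rw [Finset.sum_add_distrib]
    have hnn : 0 ≤ M₂ * ‖x‖ ^ 2 + M₁ := by positivity
    have hx2 : 0 ≤ M₁ * ‖x‖ ^ 2 := by positivity
    have sL : |∑ i : Fin N, (if i.val = 0 then T_L * (dd / R ^ 2 * x.2 i ^ 2 + d / R) -
        x.2 i * (d / R * x.2 i) else 0)| ≤ |T_L| * (M₂ * ‖x‖ ^ 2 + M₁) + M₁ * ‖x‖ ^ 2 := by
      by_cases hN : 0 < N
      · rw [sum_ite_val_eq hN]; exact hbath T_L _
      · have : N = 0 := by omega
        subst this
        simp only [Finset.univ_eq_empty, Finset.sum_empty, abs_zero]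
        positivity
    have sR : |∑ i : Fin N, (if i.val = N - 1 then T_R * (dd / R ^ 2 * x.2 i ^ 2 + d / R) -
        x.2 i * (d / R * x.2 i) else 0)| ≤ |T_R| * (M₂ * ‖x‖ ^ 2 + M₁) + M₁ * ‖x‖ ^ 2 := by
      by_cases hN : 0 < N
      · rw [sum_ite_val_eq (Nat.sub_lt hN one_pos)]; exact hbath T_R _
      · have : N = 0 := by omega
        subst this
        simp only [Finset.univ_eq_empty, Finset.sum_empty, abs_zero]
        positivity
    calc _ ≤ _ := abs_add_le _ _
      _ ≤ (|T_L| * (M₂ * ‖x‖ ^ 2 + M₁) + M₁ * ‖x‖ ^ 2) + (|T_R| * (M₂ * ‖x‖ ^ 2 + M₁) + M₁ * ‖x‖ ^ 2) :=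
          add_le_add sL sR
      _ = (|T_L| + |T_R|) * (M₂ * ‖x‖ ^ 2 + M₁) + 2 * M₁ * ‖x‖ ^ 2 := by ring
  calc _ ≤ _ := abs_add_le _ _
    _ ≤ M₁ * ∑ i : Fin N, (|x.2 i| * |x.1 i| + |partialQ i (P.hamiltonian N) x| * |x.2 i|) +
        |P.γ| * ((|T_L| + |T_R|) * (M₂ * ‖x‖ ^ 2 + M₁) + 2 * M₁ * ‖x‖ ^ 2) := by
        refine add_le_add h1 ?_
        rw [abs_mul]
        exact mul_le_mul_of_nonneg_left h2 (abs_nonneg _)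

/-- At a fixed point the cut-off is eventually flat along `R = n + 1 → ∞`:
`χ(H₀/R) = 1`, `χ'(H₀/R) = 0`, `χ''(H₀/R) = 0`. [folklore] -/
theorem eventually_refCutoff_flat (x : PhaseSpace N) :
    ∀ᶠ n : ℕ in atTop, smoothCutoff ((⟨fun q => q ^ 2 / 2, fun _ => 0, 0⟩ : OscillatorChain).hamiltonian N x / ((n : ℝ) + 1)) = 1 ∧
      deriv smoothCutoff ((⟨fun q => q ^ 2 / 2, fun _ => 0, 0⟩ : OscillatorChain).hamiltonian N x / ((n : ℝ) + 1)) = 0 ∧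
        deriv (deriv smoothCutoff) ((⟨fun q => q ^ 2 / 2, fun _ => 0, 0⟩ : OscillatorChain).hamiltonian N x / ((n : ℝ) + 1)) = 0 := by
  refine eventually_atTop.2 ⟨⌈(⟨fun q => q ^ 2 / 2, fun _ => 0, 0⟩ : OscillatorChain).hamiltonian N x⌉₊, fun n hn => smoothCutoff_div_of_lt (by positivity) ?_⟩
  have h1 := Nat.le_ceil ((⟨fun q => q ^ 2 / 2, fun _ => 0, 0⟩ : OscillatorChain).hamiltonian N x)
  have h2 : (⌈(⟨fun q => q ^ 2 / 2, fun _ => 0, 0⟩ : OscillatorChain).hamiltonian N x⌉₊ : ℝ) ≤ n := by exact_mod_cast hn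
  linarith

/-- At a fixed point, `L χ(H₀/(n+1)) = 0` eventually along `n → ∞` (the cut-off is flat there).
[folklore] -/
theorem eventually_generator_refCutoff_eq_zero (P : OscillatorChain) (T_L T_R : ℝ) (x : PhaseSpace N) :
    ∀ᶠ n : ℕ in atTop,
      P.generator N T_L T_R (fun y => smoothCutoff ((⟨fun q => q ^ 2 / 2, fun _ => 0, 0⟩ : OscillatorChain).hamiltonian N y / ((n : ℝ) + 1))) x = 0 := by
  filter_upwards [eventually_refCutoff_flat x] with n hn
  rw [generator_refCutoff_eq, hn.2.1, hn.2.2]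
  simp

/-- At a fixed point, `χ(H₀/(n+1)) = 1` eventually. [folklore] -/
theorem eventually_refCutoff_eq_one (x : PhaseSpace N) :
    ∀ᶠ n : ℕ in atTop, smoothCutoff ((⟨fun q => q ^ 2 / 2, fun _ => 0, 0⟩ : OscillatorChain).hamiltonian N x / ((n : ℝ) + 1)) = 1 :=
  (eventually_refCutoff_flat x).mono fun _ h => h.1

/-- `|χ(H₀/R)| ≤ 1`. [folklore] -/
theorem abs_refCutoff_le_one (R : ℝ) (x : PhaseSpace N) :
    |smoothCutoff ((⟨fun q => q ^ 2 / 2, fun _ => 0, 0⟩ : OscillatorChain).hamiltonian N x / R)| ≤ 1 :=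
  abs_smoothCutoff_le_one _

end Summit.AtomisticToContinuum.FouriersLaw.Theorems.WindowLimit

end
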